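import Literature.Analysis.FluidPDE.RusinSverakLerayStability
import Literature.Analysis.FluidPDE.CKNInterpolationEstimate
import Literature.Analysis.FluidPDE.PressureDecayEstimate
import HarnessLib

/-!
# Backward-cylinder boundedness makes an interior point regular: the bridge **B** of
`RusinSverakLerayStability.lean` from the pressure decay estimate and the one-scale criterion

Analysis/FluidPDE proof file (no new definitions, no new named facts) in the decomposition of the
named fact `Literature.Analysis.FluidPDE.rusin_sverak_leray_singular_points_stable`
(`RusinSverakLeraySolutions.lean`; Rusin–Šverák, J. Funct. Anal. 260 (2011) = arXiv:0911.0500,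
Thm. 4.2 with Lemma 2.1), which `RusinSverakLerayStability.lean` proves from three named facts
**K**, **L**, **B**. This file **proves B** = `isRegularPoint_of_eLpNorm_parabolicCylinder_lt_top`
— a suitable weak solution `(u, p)` (unit viscosity, no force) on an open `O ∋ z = (t, x)` that is
essentially bounded on a backward cylinder `Q_R(z) ⊆ O` is essentially bounded on a full
neighbourhood of `z` — from two leaves of the Caffarelli–Kohn–Nirenberg theory already used by
the tree's decomposition of ns.S12 (`CKNEpsilonRegularityAssembly.lean`):

* `seregin_sverak_pressure_decay` (`PressureDecayEstimate.lean`; Seregin–Šverák 2009, (as13)):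
  `D(ϱ; z) ≤ c [(ϱ/r) D(r; z) + (r/ϱ)² C(r; z)]`, `0 < ϱ ≤ r`;
* `oneScaleRegularity` (`CKNEpsilonRegularityAssembly.lean`; Caffarelli–Kohn–Nirenberg 1982,
  Prop. 1 = Robinson–Rodrigo–Sadowski 2016, Thm. 15.4 = Rusin–Šverák's Prop. 2.1 in its one-scale
  form): `C(r; z') + D(r; z') ≤ ε₀` gives `u ∈ L^∞(Q_{r/2}(z'))`;

together with the **proved** interpolation inequality `interpolationEstimate_holds`
(`CKNInterpolationEstimate.lean`, used only for `u ∈ L³` near `z`) and the accepted cylinder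
geometry of `CKN1982Setting.lean`.

## The proof (`isRegularPoint_of_eLpNorm_parabolicCylinder_lt_top_of_pressure_decay`)

This is the argument sketched in the docstring of **B** and in Robinson–Rodrigo–Sadowski 2016,
p. 227 ("it is a peculiar feature of Theorem 15.4 that it does not guarantee that `(0,0)` is a
regular point [...] `Q*_{r/2}(x,t) = Q_{r/2}(x, t + r²/8)`", Cor. 15.6), made quantitative by the
pressure decay estimate instead of an explicit harmonic split. Let `|u| ≤ M` a.e. on `Q_R(z)`,
`z = (t, x)`, and fix a closed box `K = [t - r₁², t + r₁²] × B̄(x, r₁) ⊆ O`.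

1. *Scales.* With `c` the constant of the decay estimate choose `θ ≤ 1/2` with `c θ ≤ 1/2`;
   along the scales `s_j = θʲ r₀` at a centre `z'` the estimate reads
   `D(s_{j+1}) ≤ ½ D(s_j) + c θ⁻² C(s_j)`, so that (`iterate_half_discrete`)
   `D(s_J) ≤ 2^{-J} D(r₀) + 2 c θ⁻² e` whenever `C(s_j) ≤ e` for `j < J`
   (`cknD_iterate_le_of_pressure_decay`).
2. *The cubic term at a shifted centre* `z' = (t + h, x)`, `0 < h`: `Q_s(z')` lies in
   `Q_s(z) ∪ ({t} × B) ∪ ((t, t + h) × B_{r₀}(x))`, so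
   `C(s; z') ≤ |B₁| M³ s³ + s⁻² ∫∫_{(t,t+h)×B_{r₀}} |u|³` (`cknC_shift_le`), and the last integral
   tends to `0` as `h → 0⁺` because `u ∈ L³((t, t + r₀²) × B_{r₀})` — this set is the cylinder
   `Q_{r₀}(t + r₀², x) ⋐ O`, on which `C < ∞` by the interpolation inequality and the local energy
   classes (continuity from above of `A ↦ ∫∫_A |u|³`).
3. *Choice of parameters.* `r₀` makes `|B₁| M³ r₀³` small, `J` makes `2^{-J} r₀⁻² ∫_K |p|^{3/2}`
   small, then `h ≤ s_J²/8` makes the slab term small: `C(s_J; z') + D(s_J; z') ≤ ε₀`.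
4. *Conclusion.* The one-scale criterion bounds `u` on `Q_{s_J/2}(t + h, x) ⊇ Q*_{√h}(t, x)`
   (`parabolicCylinderCentered_subset_shift`), so `z` is regular
   (`isRegularPoint_of_eLpNorm_shift_lt_top`).

The tools of steps 1, 2 and 4 are stated separately because the stability of singularities
(**L**, Rusin–Šverák's Lemma 2.1) is proved by the same scheme in
`RusinSverakSingularityStability.lean`, the vanishing slab term being replaced by the vanishing
`L³` distance `∫∫ |u^k - u|³`.

## Mathlib / tree search

Tree: `oneScaleRegularity`, `interpolationEstimate(_holds)`, `closure_parabolicCylinder_shift_subset_box`,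
`cknD_le_of_subset`, `cknE_le_of_subset` (`CKNEpsilonRegularityAssembly.lean`,
`CKNInterpolationEstimate.lean`); `parabolicCylinderCentered_subset_shift`, `parabolicCylinder_mono`,
`exists_inv_two_pow_mul_le`, `cknAEss_le_of_energy` (`CKN1982Setting.lean`);
`exists_closedCylinder_subset`, `finrank_euclideanSpace_three` (`CKNEpsilonRegularity.lean`).
Mathlib: `tendsto_measure_iInter_atTop` (continuity from above), `withDensity_apply`,
`enorm_ae_le_eLpNormEssSup`, `Measure.addHaar_ball_of_pos`, `lintegral_union_le`,
`ENNReal.Tendsto.const_mul`.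

## References

* W. Rusin, V. Šverák, J. Funct. Anal. 260 (2011) = arXiv:0911.0500, Prop. 2.1 (half-open
  cylinders `Q_{z₀,r} = B_{x₀,r} × (t₀ - r², t₀]`) and the proof of Lemma 2.1, p. 4.
* J. C. Robinson, J. L. Rodrigo, W. Sadowski, *The three-dimensional Navier–Stokes equations*
  (2016), Thm. 15.4, the remark after Cor. 15.5, Cor. 15.6 (p. 227).
* G. Seregin, V. Šverák, Comm. PDE 34 (2009) = arXiv:0804.1803, proof of Lemma 3.5, (as13) and
  its iteration (p. 10).
* L. Caffarelli, R. Kohn, L. Nirenberg, CPAM 35 (1982), Prop. 1 and §6 (shift of the centre).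
-/

noncomputable section

open MeasureTheory Set Function Filter Topology TopologicalSpace Metric
open scoped NNReal ENNReal

namespace Literature.Analysis.FluidPDE


/-! ### Step 1: the discrete iteration of the pressure decay estimate -/

/-- **Discrete halving iteration** in `ℝ≥0∞`: if `d (j+1) ≤ d j / 2 + A` for all `j < J`, then
`d J ≤ 2^{-J} d 0 + 2 A` (the "routine" iteration of Seregin–Šverák 2009, p. 10; cf.
`CKN1982.iterate_half_le` for the continuous-radius version). [folklore] -/
theorem iterate_half_discrete {d : ℕ → ℝ≥0∞} {A : ℝ≥0∞} (J : ℕ)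
    (h : ∀ j < J, d (j + 1) ≤ 2⁻¹ * d j + A) :
    d J ≤ (2⁻¹ : ℝ≥0∞) ^ J * d 0 + 2 * A := by
  induction J with
  | zero => simp
  | succ n ih =>
    have ih' := ih fun j hj => h j (Nat.lt_succ_of_lt hj)
    calc d (n + 1) ≤ 2⁻¹ * d n + A := h n (Nat.lt_succ_self n)
      _ ≤ 2⁻¹ * ((2⁻¹ : ℝ≥0∞) ^ n * d 0 + 2 * A) + A := by gcongr
      _ = (2⁻¹ : ℝ≥0∞) ^ (n + 1) * d 0 + ((2⁻¹ * 2) * A + A) := by ring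
      _ = (2⁻¹ : ℝ≥0∞) ^ (n + 1) * d 0 + 2 * A := by
          rw [ENNReal.inv_mul_cancel two_ne_zero ENNReal.ofNat_ne_top, one_mul, two_mul]

/-- **A ratio `θ` absorbing the constant of the decay estimate**: for `c ≥ 0` there is
`θ ∈ (0, 1/2]` with `c θ ≤ 1/2` (in `ℝ≥0∞`). [folklore] -/
theorem exists_ratio_mul_le_half (c : ℝ≥0) :
    ∃ θ : ℝ, 0 < θ ∧ θ ≤ 1 / 2 ∧ (c : ℝ≥0∞) * ENNReal.ofReal θ ≤ 2⁻¹ := by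
  refine ⟨min (1 / 2) (1 / (2 * ((c : ℝ) + 1))), by positivity, min_le_left _ _, ?_⟩
  have hc0 : (0 : ℝ) ≤ c := c.coe_nonneg
  have hle : (c : ℝ) * min (1 / 2) (1 / (2 * ((c : ℝ) + 1))) ≤ 1 / 2 := by
    calc (c : ℝ) * min (1 / 2) (1 / (2 * ((c : ℝ) + 1)))
        ≤ (c : ℝ) * (1 / (2 * ((c : ℝ) + 1))) :=
          mul_le_mul_of_nonneg_left (min_le_right _ _) hc0
      _ = ((c : ℝ) / ((c : ℝ) + 1)) * (1 / 2) := by field_simp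
      _ ≤ 1 * (1 / 2) := by
          gcongr
          rw [div_le_one (by positivity)]
          linarith
      _ = 1 / 2 := one_mul _
  calc (c : ℝ≥0∞) * ENNReal.ofReal (min (1 / 2) (1 / (2 * ((c : ℝ) + 1))))
      = ENNReal.ofReal ((c : ℝ) * min (1 / 2) (1 / (2 * ((c : ℝ) + 1)))) := by
        rw [ENNReal.ofReal_mul hc0, ENNReal.ofReal_coe_nnreal]
    _ ≤ ENNReal.ofReal (1 / 2) := ENNReal.ofReal_le_ofReal hle
    _ = 2⁻¹ := by rw [one_div, ENNReal.ofReal_inv_of_pos two_pos, ENNReal.ofReal_ofNat]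

/-- **The pressure decay estimate iterated along the scales `θʲ r₀`** (Seregin–Šverák 2009,
p. 10: "The latter inequality can be easily iterated"). Let `c` be a constant for which the
ratio form of `seregin_sverak_pressure_decay` holds, `θ ∈ (0, 1]` with `c θ ≤ 1/2`, `(u, p)` a
distributional solution on `Q` with `Q_{r₀}(z') ⊆ Q`, and suppose `C(θʲ r₀; z') ≤ e` for
all `j < J`. Then `D(θᴶ r₀; z') ≤ 2^{-J} D(r₀; z') + 2 c θ⁻² e`.
[cite: SereginSverak2009, proof of Lemma 3.5, (as13) and its iteration (arXiv:0804.1803 p. 10)] -/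
theorem cknD_iterate_le_of_pressure_decay {c : ℝ≥0}
    (hPD : ∀ (Q : Opens (ℝ × (EuclideanSpace ℝ (Fin 3)))) (u : ℝ → (EuclideanSpace ℝ (Fin 3)) → (EuclideanSpace ℝ (Fin 3))) (p : ℝ → (EuclideanSpace ℝ (Fin 3)) → ℝ),
      IsDistributionalNSSolutionOn Q 1 0 u p →
      ∀ (z : ℝ × (EuclideanSpace ℝ (Fin 3))) (r θ : ℝ), 0 < r → 0 < θ → θ ≤ 1 →
        parabolicCylinder r z ⊆ (Q : Set (ℝ × (EuclideanSpace ℝ (Fin 3)))) →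
        cknD (θ * r) z p ≤
          c * (ENNReal.ofReal θ * cknD r z p + ENNReal.ofReal ((θ⁻¹) ^ 2) * cknC r z u))
    {θ : ℝ} (hθ : 0 < θ) (hθ1 : θ ≤ 1) (hcθ : (c : ℝ≥0∞) * ENNReal.ofReal θ ≤ 2⁻¹)
    {Q : Opens (ℝ × (EuclideanSpace ℝ (Fin 3)))} {u : ℝ → (EuclideanSpace ℝ (Fin 3)) → (EuclideanSpace ℝ (Fin 3))} {p : ℝ → (EuclideanSpace ℝ (Fin 3)) → ℝ} (hdist : IsDistributionalNSSolutionOn Q 1 0 u p)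
    {z' : ℝ × (EuclideanSpace ℝ (Fin 3))} {r₀ : ℝ} (hr₀ : 0 < r₀)
    (hsubQ : parabolicCylinder r₀ z' ⊆ (Q : Set (ℝ × (EuclideanSpace ℝ (Fin 3))))) {e : ℝ≥0∞} {J : ℕ}
    (hC : ∀ j < J, cknC (θ ^ j * r₀) z' u ≤ e) :
    cknD (θ ^ J * r₀) z' p ≤
      (2⁻¹ : ℝ≥0∞) ^ J * cknD r₀ z' p + 2 * (c * ENNReal.ofReal ((θ⁻¹) ^ 2) * e) := by
  have hs0 : ∀ j : ℕ, 0 < θ ^ j * r₀ := fun j => by positivity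
  have hsle : ∀ j : ℕ, θ ^ j * r₀ ≤ r₀ := fun j =>
    mul_le_of_le_one_left hr₀.le (pow_le_one₀ hθ.le hθ1)
  have hsubj : ∀ j : ℕ, parabolicCylinder (θ ^ j * r₀) z' ⊆ (Q : Set (ℝ × (EuclideanSpace ℝ (Fin 3)))) :=
    fun j => (parabolicCylinder_mono (hs0 j).le (hsle j) z').trans hsubQ
  have step : ∀ j < J, cknD (θ ^ (j + 1) * r₀) z' p ≤
      2⁻¹ * cknD (θ ^ j * r₀) z' p + c * ENNReal.ofReal ((θ⁻¹) ^ 2) * e := by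
    intro j hj
    have H := hPD Q u p hdist z' (θ ^ j * r₀) θ (hs0 j) hθ hθ1 (hsubj j)
    rw [show θ * (θ ^ j * r₀) = θ ^ (j + 1) * r₀ by rw [pow_succ]; ring] at H
    calc cknD (θ ^ (j + 1) * r₀) z' p
        ≤ c * (ENNReal.ofReal θ * cknD (θ ^ j * r₀) z' p +
            ENNReal.ofReal ((θ⁻¹) ^ 2) * cknC (θ ^ j * r₀) z' u) := H
      _ = (c * ENNReal.ofReal θ) * cknD (θ ^ j * r₀) z' p +
            c * ENNReal.ofReal ((θ⁻¹) ^ 2) * cknC (θ ^ j * r₀) z' u := by ring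
      _ ≤ 2⁻¹ * cknD (θ ^ j * r₀) z' p + c * ENNReal.ofReal ((θ⁻¹) ^ 2) * e := by
          gcongr
          exact hC j hj
  have := iterate_half_discrete (d := fun j => cknD (θ ^ j * r₀) z' p) J step
  simpa using this

/-! ### Step 2: the cubic term near a point where `u` is bounded -/

/-- Volume of a backward parabolic cylinder in `ℝ × ℝ³`: `|Q_r(z)| = r⁵ |B₁|` for `r > 0`. [folklore] -/
theorem volume_parabolicCylinder {r : ℝ} (hr : 0 < r) (z : ℝ × (EuclideanSpace ℝ (Fin 3))) :
    volume (parabolicCylinder r z) = ENNReal.ofReal (r ^ 5) * volume (ball (0 : (EuclideanSpace ℝ (Fin 3))) 1) := by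
  rw [parabolicCylinder, Measure.volume_eq_prod, Measure.prod_prod, Real.volume_Ioo,
    Measure.addHaar_ball_of_pos volume z.2 hr, finrank_euclideanSpace_three, ← mul_assoc,
    ← ENNReal.ofReal_mul (by nlinarith)]
  congr 2
  ring

/-- `s⁻² · s⁵ = s³` for the `ℝ≥0∞` normalisations of `C` and `D`. [folklore] -/
theorem inv_ofReal_sq_mul_ofReal_pow_five {s : ℝ} (hs : 0 < s) :
    (ENNReal.ofReal s ^ 2)⁻¹ * ENNReal.ofReal (s ^ 5) = ENNReal.ofReal (s ^ 3) := by
  rw [← ENNReal.ofReal_pow hs.le, ← ENNReal.ofReal_inv_of_pos (by positivity),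
    ← ENNReal.ofReal_mul (by positivity)]
  congr 1
  field_simp

/-- **Cubes under an essential bound**: if `‖u‖ₑ ≤ M` a.e. on `S ⊇ V`, then
`∫∫_V |u|³ ≤ M³ |V|`. [folklore] -/
theorem setLIntegral_cube_le_of_ae_bound {S V : Set (ℝ × (EuclideanSpace ℝ (Fin 3)))} {u : ℝ → (EuclideanSpace ℝ (Fin 3)) → (EuclideanSpace ℝ (Fin 3))} {M : ℝ≥0∞}
    (hV : V ⊆ S) (hb : ∀ᵐ w ∂(volume.restrict S), ‖u w.1 w.2‖ₑ ≤ M) :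
    ∫⁻ w in V, ‖u w.1 w.2‖ₑ ^ (3 : ℕ) ≤ M ^ 3 * volume V := by
  calc ∫⁻ w in V, ‖u w.1 w.2‖ₑ ^ (3 : ℕ) ≤ ∫⁻ _ in V, M ^ 3 := by
        refine lintegral_mono_ae ?_
        filter_upwards [ae_restrict_of_ae_restrict_of_subset hV hb] with w hw
        gcongr
    _ = M ^ 3 * volume V := setLIntegral_const V _

/-- An essential `L^∞` bound on a set, in `ℝ≥0∞` form: `‖u‖ₑ ≤ ‖u‖_{L^∞(S)}` a.e. on `S`. [folklore] -/
theorem ae_enorm_le_eLpNorm_top (u : ℝ → (EuclideanSpace ℝ (Fin 3)) → (EuclideanSpace ℝ (Fin 3))) (S : Set (ℝ × (EuclideanSpace ℝ (Fin 3)))) :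
    ∀ᵐ w ∂(volume.restrict S), ‖u w.1 w.2‖ₑ ≤ eLpNorm (uncurry u) ∞ (volume.restrict S) := by
  rw [eLpNorm_exponent_top]
  exact enorm_ae_le_eLpNormEssSup (uncurry u) (volume.restrict S)

/-- **The cubic quantity at a shifted centre.** Let `z = (t, x)`, `0 < s ≤ r₀`, `0 < h`. Then
`Q_s(t + h, x) ⊆ Q_s(z) ∪ ({t} × B_{r₀}(x)) ∪ ((t, t + h) × B_{r₀}(x))`, the middle set being
Lebesgue-null; hence if `‖u‖ₑ ≤ M` a.e. on a set `S ⊇ Q_s(z)`,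
`C(s; (t + h, x)) ≤ |B₁| M³ s³ + s⁻² ∫∫_{(t,t+h) × B_{r₀}(x)} |u|³`. [folklore] -/
theorem cknC_shift_le {u : ℝ → (EuclideanSpace ℝ (Fin 3)) → (EuclideanSpace ℝ (Fin 3))} {z : ℝ × (EuclideanSpace ℝ (Fin 3))} {S : Set (ℝ × (EuclideanSpace ℝ (Fin 3)))} {M : ℝ≥0∞} {s r₀ h : ℝ}
    (hs : 0 < s) (hsr₀ : s ≤ r₀) (hh : 0 < h) (hS : parabolicCylinder s z ⊆ S)
    (hb : ∀ᵐ w ∂(volume.restrict S), ‖u w.1 w.2‖ₑ ≤ M) :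
    cknC s (z.1 + h, z.2) u ≤
      volume (ball (0 : (EuclideanSpace ℝ (Fin 3))) 1) * M ^ 3 * ENNReal.ofReal (s ^ 3) +
        (ENNReal.ofReal s ^ 2)⁻¹ * ∫⁻ w in Ioo z.1 (z.1 + h) ×ˢ ball z.2 r₀, ‖u w.1 w.2‖ₑ ^ (3 : ℕ) := by
  -- the covering
  have hcover : parabolicCylinder s (z.1 + h, z.2) ⊆
      (parabolicCylinder s z ∪ {z.1} ×ˢ ball z.2 r₀) ∪ Ioo z.1 (z.1 + h) ×ˢ ball z.2 r₀ := by
    intro w hw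
    rw [mem_parabolicCylinder] at hw
    obtain ⟨⟨h1, h2⟩, h3⟩ := hw
    dsimp only at h1 h2 h3
    have h3' : w.2 ∈ ball z.2 r₀ := mem_ball.2 (h3.trans_le hsr₀)
    rcases lt_trichotomy w.1 z.1 with hlt | heq | hgt
    · left; left
      rw [mem_parabolicCylinder]
      exact ⟨⟨by linarith, hlt⟩, h3⟩
    · left; right
      exact ⟨heq, h3'⟩
    · right
      exact ⟨⟨hgt, h2⟩, h3'⟩
  -- the three pieces
  have hnull : ∫⁻ w in ({z.1} : Set ℝ) ×ˢ ball z.2 r₀, ‖u w.1 w.2‖ₑ ^ (3 : ℕ) = 0 := by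
    refine setLIntegral_measure_zero _ _ ?_
    rw [Measure.volume_eq_prod, Measure.prod_prod, Real.volume_singleton, zero_mul]
  have hmain : ∫⁻ w in parabolicCylinder s z, ‖u w.1 w.2‖ₑ ^ (3 : ℕ) ≤
      M ^ 3 * (ENNReal.ofReal (s ^ 5) * volume (ball (0 : (EuclideanSpace ℝ (Fin 3))) 1)) := by
    rw [← volume_parabolicCylinder hs z]
    exact setLIntegral_cube_le_of_ae_bound hS hb
  have hint : ∫⁻ w in parabolicCylinder s (z.1 + h, z.2), ‖u w.1 w.2‖ₑ ^ (3 : ℕ) ≤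
      M ^ 3 * (ENNReal.ofReal (s ^ 5) * volume (ball (0 : (EuclideanSpace ℝ (Fin 3))) 1)) +
        ∫⁻ w in Ioo z.1 (z.1 + h) ×ˢ ball z.2 r₀, ‖u w.1 w.2‖ₑ ^ (3 : ℕ) := by
    calc ∫⁻ w in parabolicCylinder s (z.1 + h, z.2), ‖u w.1 w.2‖ₑ ^ (3 : ℕ)
        ≤ ∫⁻ w in (parabolicCylinder s z ∪ {z.1} ×ˢ ball z.2 r₀) ∪ Ioo z.1 (z.1 + h) ×ˢ ball z.2 r₀,
            ‖u w.1 w.2‖ₑ ^ (3 : ℕ) := lintegral_mono_set hcover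
      _ ≤ (∫⁻ w in parabolicCylinder s z ∪ {z.1} ×ˢ ball z.2 r₀, ‖u w.1 w.2‖ₑ ^ (3 : ℕ)) +
            ∫⁻ w in Ioo z.1 (z.1 + h) ×ˢ ball z.2 r₀, ‖u w.1 w.2‖ₑ ^ (3 : ℕ) :=
          lintegral_union_le _ _ _
      _ ≤ ((∫⁻ w in parabolicCylinder s z, ‖u w.1 w.2‖ₑ ^ (3 : ℕ)) +
            ∫⁻ w in ({z.1} : Set ℝ) ×ˢ ball z.2 r₀, ‖u w.1 w.2‖ₑ ^ (3 : ℕ)) +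
            ∫⁻ w in Ioo z.1 (z.1 + h) ×ˢ ball z.2 r₀, ‖u w.1 w.2‖ₑ ^ (3 : ℕ) := by
          gcongr
          exact lintegral_union_le _ _ _
      _ ≤ _ := by rw [hnull, add_zero]; gcongr
  -- normalise
  have hs2 : (ENNReal.ofReal s ^ 2)⁻¹ ≠ ∞ :=
    ENNReal.inv_ne_top.2 (pow_ne_zero _ (ENNReal.ofReal_pos.2 hs).ne')
  rw [cknC]
  calc (ENNReal.ofReal s ^ 2)⁻¹ * ∫⁻ w in parabolicCylinder s (z.1 + h, z.2), ‖u w.1 w.2‖ₑ ^ (3 : ℕ)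
      ≤ (ENNReal.ofReal s ^ 2)⁻¹ * (M ^ 3 * (ENNReal.ofReal (s ^ 5) * volume (ball (0 : (EuclideanSpace ℝ (Fin 3))) 1)) +
          ∫⁻ w in Ioo z.1 (z.1 + h) ×ˢ ball z.2 r₀, ‖u w.1 w.2‖ₑ ^ (3 : ℕ)) := by gcongr
    _ = volume (ball (0 : (EuclideanSpace ℝ (Fin 3))) 1) * M ^ 3 * ((ENNReal.ofReal s ^ 2)⁻¹ * ENNReal.ofReal (s ^ 5)) +
          (ENNReal.ofReal s ^ 2)⁻¹ *
            ∫⁻ w in Ioo z.1 (z.1 + h) ×ˢ ball z.2 r₀, ‖u w.1 w.2‖ₑ ^ (3 : ℕ) := by ring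
    _ = _ := by rw [inv_ofReal_sq_mul_ofReal_pow_five hs]

/-- **`u ∈ L³` on cylinders compactly inside the domain** (from the interpolation inequality,
Robinson–Rodrigo–Sadowski 2016, Lemma 15.10, proved as `interpolationEstimate_holds`, and the
local energy classes of a suitable weak solution): if `closure`-free data are given on a set
`K ⊆ O` — the energy bound `hE` of `IsSuitableWeakSolutionOn.energyClass` and a weak spatial
gradient `G` with `∫_K |G|² < ∞` — then `∫∫_{Q_r(w)} |u|³ < ∞` for every cylinder
`Q_r(w) ⊆ K`. [cite: RobinsonRodrigoSadowski2016, Lemma 15.10 (15.31)] -/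
theorem lintegral_cube_parabolicCylinder_lt_top_of_energy {O : Opens (ℝ × (EuclideanSpace ℝ (Fin 3)))} {u : ℝ → (EuclideanSpace ℝ (Fin 3)) → (EuclideanSpace ℝ (Fin 3))}
    {G : ℝ → (EuclideanSpace ℝ (Fin 3)) → (EuclideanSpace ℝ (Fin 3)) →L[ℝ] (EuclideanSpace ℝ (Fin 3))} (hG : HasWeakSpatialGradientOn O u G) {K : Set (ℝ × (EuclideanSpace ℝ (Fin 3)))}
    (hKO : K ⊆ (O : Set (ℝ × (EuclideanSpace ℝ (Fin 3))))) {CK : ℝ≥0}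
    (hE : ∀ᵐ t : ℝ, ∫⁻ x, K.indicator (fun z : ℝ × (EuclideanSpace ℝ (Fin 3)) => ‖u z.1 z.2‖ₑ ^ 2) (t, x) ≤ CK)
    (hGK : ∫⁻ w in K, ENNReal.ofReal (frobeniusNormSq (G w.1 w.2)) < ∞)
    {w : ℝ × (EuclideanSpace ℝ (Fin 3))} {r : ℝ} (hr : 0 < r) (hsub : parabolicCylinder r w ⊆ K) :
    ∫⁻ v in parabolicCylinder r w, ‖u v.1 v.2‖ₑ ^ (3 : ℕ) < ∞ := by
  obtain ⟨C₀, hIE⟩ := interpolationEstimate_holds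
  have hrinv : (ENNReal.ofReal r)⁻¹ ≠ ∞ := ENNReal.inv_ne_top.2 (ENNReal.ofReal_pos.2 hr).ne'
  have hAfin : cknAEss r w u ≠ ∞ :=
    ne_top_of_le_ne_top (ENNReal.mul_ne_top hrinv ENNReal.coe_ne_top) (cknAEss_le_of_energy hE hsub)
  have hEfin : cknE r w G ≠ ∞ :=
    ne_top_of_le_ne_top (ENNReal.mul_ne_top hrinv hGK.ne) (cknE_le_of_subset G hsub)
  have hGr : HasWeakSpatialGradientOn (parabolicCylinderOpens r w) u G := hG.mono (hsub.trans hKO)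
  have hCfin : cknC r w u ≠ ∞ :=
    ne_top_of_le_ne_top (ENNReal.mul_ne_top ENNReal.coe_ne_top (ENNReal.rpow_ne_top_of_nonneg
      (by norm_num) (ENNReal.add_ne_top.2 ⟨hAfin, hEfin⟩))) (hIE u G w r hr hGr hAfin hEfin)
  -- `C(r) = r⁻² ∫∫ |u|³ < ∞` with `r⁻² ≠ 0`
  rw [cknC] at hCfin
  by_contra htop
  rw [not_lt, top_le_iff] at htop
  rw [htop, ENNReal.mul_top (ENNReal.inv_ne_zero.2 (ENNReal.pow_ne_top ENNReal.ofReal_ne_top))]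
    at hCfin
  exact hCfin rfl

/-- **Vanishing of `∫∫_{(t, t+h) × B_{r₀}(x)} |u|³` as `h → 0⁺`** (continuity from above of the
measure `|u|³ dx dt` along the slabs `(t, t + r₀²/(n+1)) × B_{r₀}(x)`, whose intersection is empty
and the first of which is the cylinder `Q_{r₀}(t + r₀², x)`, of finite `|u|³`-mass). [folklore] -/
theorem tendsto_lintegral_cube_slab {u : ℝ → (EuclideanSpace ℝ (Fin 3)) → (EuclideanSpace ℝ (Fin 3))} {z : ℝ × (EuclideanSpace ℝ (Fin 3))} {r₀ : ℝ} (hr₀ : 0 < r₀)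
    (hfin : ∫⁻ w in parabolicCylinder r₀ (z.1 + r₀ ^ 2, z.2), ‖u w.1 w.2‖ₑ ^ (3 : ℕ) < ∞) :
    Tendsto (fun n : ℕ => ∫⁻ w in Ioo z.1 (z.1 + r₀ ^ 2 / (n + 1)) ×ˢ ball z.2 r₀, ‖u w.1 w.2‖ₑ ^ (3 : ℕ))
      atTop (𝓝 0) := by
  set μ : Measure (ℝ × (EuclideanSpace ℝ (Fin 3))) := volume.withDensity fun w => ‖u w.1 w.2‖ₑ ^ (3 : ℕ) with hμ
  set S : ℕ → Set (ℝ × (EuclideanSpace ℝ (Fin 3))) := fun n => Ioo z.1 (z.1 + r₀ ^ 2 / (n + 1)) ×ˢ ball z.2 r₀ with hS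
  have hSm : ∀ n, MeasurableSet (S n) := fun n => measurableSet_Ioo.prod measurableSet_ball
  have hμS : ∀ n, μ (S n) = ∫⁻ w in S n, ‖u w.1 w.2‖ₑ ^ (3 : ℕ) := fun n =>
    withDensity_apply _ (hSm n)
  -- antitone, empty intersection, finite at `n = 0`
  have hanti : Antitone S := by
    intro n m hnm
    refine prod_mono (Ioo_subset_Ioo le_rfl ?_) Subset.rfl
    have : (n : ℝ) + 1 ≤ (m : ℝ) + 1 := by exact_mod_cast Nat.succ_le_succ hnm
    gcongr
  have hinter : (⋂ n, S n) = ∅ := by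
    refine eq_empty_iff_forall_notMem.2 fun w hw => ?_
    rw [mem_iInter] at hw
    have h0 := hw 0
    obtain ⟨⟨h1, -⟩, -⟩ := h0
    obtain ⟨n, hn⟩ := exists_nat_gt (r₀ ^ 2 / (w.1 - z.1))
    obtain ⟨⟨-, h2⟩, -⟩ := hw n
    have hpos : 0 < w.1 - z.1 := by linarith
    have h3 : r₀ ^ 2 / (w.1 - z.1) < (n : ℝ) + 1 := by linarith
    rw [div_lt_iff₀ hpos] at h3
    have h4 : r₀ ^ 2 / ((n : ℝ) + 1) < w.1 - z.1 := by
      rw [div_lt_iff₀ (by positivity)]; linarith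
    linarith
  have hS0 : S 0 ⊆ parabolicCylinder r₀ (z.1 + r₀ ^ 2, z.2) := by
    intro w hw
    obtain ⟨⟨h1, h2⟩, h3⟩ := hw
    rw [mem_parabolicCylinder]
    refine ⟨⟨by dsimp only; linarith, by dsimp only; simpa using h2⟩, h3⟩
  have hfin0 : ∃ n, μ (S n) ≠ ∞ :=
    ⟨0, by rw [hμS 0]; exact ((lintegral_mono_set hS0).trans_lt hfin).ne⟩
  have key := tendsto_measure_iInter_atTop (μ := μ) (fun n => (hSm n).nullMeasurableSet) hanti hfin0
  rw [hinter, measure_empty] at key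
  refine key.congr fun n => ?_
  rw [Function.comp_apply]
  exact hμS n

/-! ### Step 4: from a bound on a shifted backward cylinder to a regular point -/

/-- **Shifted cylinders see centred ones**: if `u ∈ L^∞(Q_{s/2}(t + h, x))` with `0 < h ≤ s²/8`,
then `(t, x)` is a regular point of `u` — `Q*_{√h}(t, x) ⊆ Q_{s/2}(t + h, x)`
(`parabolicCylinderCentered_subset_shift`; Robinson–Rodrigo–Sadowski 2016, Cor. 15.6:
`Q*_{r/2}(x,t) = Q_{r/2}(x, t + r²/8)`). [folklore] -/
theorem isRegularPoint_of_eLpNorm_shift_lt_top {u : ℝ → (EuclideanSpace ℝ (Fin 3)) → (EuclideanSpace ℝ (Fin 3))} {z : ℝ × (EuclideanSpace ℝ (Fin 3))} {s h : ℝ}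
    (hs : 0 < s) (hh : 0 < h) (hhs : h ≤ s ^ 2 / 8)
    (hb : eLpNorm (uncurry u) ∞ (volume.restrict (parabolicCylinder (s / 2) (z.1 + h, z.2))) < ∞) :
    IsRegularPoint u z := by
  set ρ : ℝ := Real.sqrt h with hρ
  have hρ0 : 0 < ρ := Real.sqrt_pos.2 hh
  have hρ2 : ρ ^ 2 = h := Real.sq_sqrt hh.le
  have hsub : parabolicCylinderCentered ρ z ⊆ parabolicCylinder (s / 2) (z.1 + h, z.2) := by
    refine parabolicCylinderCentered_subset_shift ?_ hρ2.le ?_ z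
    · have h1 : h ≤ (s / 2) ^ 2 := by nlinarith
      calc ρ = Real.sqrt h := hρ
        _ ≤ Real.sqrt ((s / 2) ^ 2) := Real.sqrt_le_sqrt h1
        _ = s / 2 := Real.sqrt_sq (by linarith)
    · rw [hρ2]; nlinarith
  exact ⟨ρ, hρ0, lt_of_le_of_lt (eLpNorm_mono_measure _ (Measure.restrict_mono hsub le_rfl)) hb⟩

/-- **The one-scale criterion for the unforced equations** (the case `f = 0` of
`oneScaleRegularity`: Caffarelli–Kohn–Nirenberg 1982, Prop. 1; Robinson–Rodrigo–Sadowski 2016,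
Thm. 15.4; Rusin–Šverák 2011, Prop. 2.1 at one scale): there is `ε₀ > 0` such that for every
suitable weak solution `(u, p)` of the unforced unit-viscosity equations on `O` and every cylinder
with `closure Q_r(z) ⊆ O`, `C(r; z) + D(r; z) ≤ ε₀` implies `u ∈ L^∞(Q_{r/2}(z))`.
[cite: CaffarelliKohnNirenberg1982, Proposition 1 and Corollary] -/
theorem oneScaleRegularity.unforced (hOS : oneScaleRegularity) :
    ∃ ε₀ : ℝ, 0 < ε₀ ∧ ∀ (O : Opens (ℝ × (EuclideanSpace ℝ (Fin 3)))) (u : ℝ → (EuclideanSpace ℝ (Fin 3)) → (EuclideanSpace ℝ (Fin 3))) (p : ℝ → (EuclideanSpace ℝ (Fin 3)) → ℝ),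
      IsSuitableWeakSolutionOn O 1 0 u p → ∀ (z : ℝ × (EuclideanSpace ℝ (Fin 3))) (r : ℝ), 0 < r →
        closure (parabolicCylinder r z) ⊆ (O : Set (ℝ × (EuclideanSpace ℝ (Fin 3)))) →
        cknC r z u + cknD r z p ≤ ENNReal.ofReal ε₀ →
        eLpNorm (uncurry u) ∞ (volume.restrict (parabolicCylinder (r / 2) z)) < ∞ := by
  obtain ⟨ε₀, hε₀, H⟩ := hOS
  obtain ⟨κ, hκ, H⟩ := H 3 (by norm_num)
  refine ⟨ε₀, hε₀, fun O u p hsws z r hr hcl hsmall => ?_⟩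
  have hf : MemLp (uncurry (0 : ℝ → (EuclideanSpace ℝ (Fin 3)) → (EuclideanSpace ℝ (Fin 3)))) (ENNReal.ofReal 3) (volume.restrict (O : Set (ℝ × (EuclideanSpace ℝ (Fin 3))))) := by
    rw [uncurry_zero]; exact MemLp.zero
  have hdiv : ∀ φ : ℝ → (EuclideanSpace ℝ (Fin 3)) → ℝ, IsSpaceTimeTestOn O φ →
      ∫ t, ∫ x, inner ℝ ((0 : ℝ → (EuclideanSpace ℝ (Fin 3)) → (EuclideanSpace ℝ (Fin 3))) t x) (gradient (φ t) x) = 0 := fun φ _ => by simp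
  have hF : cknF 3 r z (0 : ℝ → (EuclideanSpace ℝ (Fin 3)) → (EuclideanSpace ℝ (Fin 3))) ≤ ENNReal.ofReal κ := by
    have : cknF 3 r z (0 : ℝ → (EuclideanSpace ℝ (Fin 3)) → (EuclideanSpace ℝ (Fin 3))) = 0 := by
      simp [cknF, ENNReal.zero_rpow_of_pos (by norm_num : (0 : ℝ) < 3)]
    rw [this]; exact bot_le
  exact H O 0 u p hsws hf hdiv z r hr hcl hsmall hF

/-! ### Step 3 and the assembly: **B** from the pressure decay estimate and the one-scale criterion -/

/-- Small scales make `ofReal (r³) · N` small (`N < ∞`). [folklore] -/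
theorem exists_forall_ofReal_pow_three_mul_le {N b : ℝ≥0∞} (hN : N ≠ ∞) (hb : 0 < b) :
    ∃ r₁ : ℝ, 0 < r₁ ∧ ∀ r, 0 < r → r ≤ r₁ → ENNReal.ofReal (r ^ 3) * N ≤ b := by
  obtain ⟨rF, hrF, hlt⟩ := exists_forall_ofReal_rpow_mul_lt (s := 3) (by norm_num) hN hb
  refine ⟨rF / 2, by positivity, fun r hr hrr => ?_⟩
  have := hlt r hr (by linarith)
  rw [show (r ^ (3 : ℝ)) = r ^ (3 : ℕ) by exact_mod_cast Real.rpow_natCast r 3] at this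
  exact this.le

/-- Three quarters make less than a whole: `b/4 + b/4 + b/4 ≤ b` in `ℝ≥0∞`. [folklore] -/
theorem ENNReal.add_quarters_le (b : ℝ≥0∞) : b / 4 + b / 4 + b / 4 ≤ b := by
  calc b / 4 + b / 4 + b / 4 ≤ b / 4 + b / 4 + b / 4 + b / 4 := le_self_add
    _ = b := by
        rw [show b / 4 + b / 4 + b / 4 + b / 4 = 4 * (b / 4) by ring]
        exact ENNReal.mul_div_cancel (by norm_num) (by norm_num)

/-- **B from the pressure decay estimate and an unforced one-scale criterion** (core of
`isRegularPoint_of_eLpNorm_parabolicCylinder_lt_top_of_pressure_decay`, with the ε-regularity input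
abstracted to its unforced one-scale shape — `C(r; z') + D(r; z') ≤ ε₀` on a cylinder compactly
inside the domain bounds `u` on `Q_{r/2}(z')` — so that it can be fed either by
`oneScaleRegularity` (`oneScaleRegularity.unforced`) or by Lemarié-Rieusset's Thm. 14.4
(`lemarieRieusset_epsilon_regularity`). Proof: module docstring, steps 1–4.
[cite: RusinSverak2011, Prop. 2.1 (half-open Q_{z₀,r}, arXiv:0911.0500 p. 4); RobinsonRodrigoSadowski2016 Cor. 15.6] -/
theorem isRegularPoint_of_eLpNorm_parabolicCylinder_lt_top_of_unforced
    (hPD : seregin_sverak_pressure_decay)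
    (hU : ∃ ε₀ : ℝ, 0 < ε₀ ∧ ∀ (O : Opens (ℝ × (EuclideanSpace ℝ (Fin 3)))) (u : ℝ → (EuclideanSpace ℝ (Fin 3)) → (EuclideanSpace ℝ (Fin 3))) (p : ℝ → (EuclideanSpace ℝ (Fin 3)) → ℝ),
      IsSuitableWeakSolutionOn O 1 0 u p → ∀ (z : ℝ × (EuclideanSpace ℝ (Fin 3))) (r : ℝ), 0 < r →
        closure (parabolicCylinder r z) ⊆ (O : Set (ℝ × (EuclideanSpace ℝ (Fin 3)))) →
        cknC r z u + cknD r z p ≤ ENNReal.ofReal ε₀ →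
        eLpNorm (uncurry u) ∞ (volume.restrict (parabolicCylinder (r / 2) z)) < ∞) :
    isRegularPoint_of_eLpNorm_parabolicCylinder_lt_top := by
  intro O u p hsws z hz R hR hQR hbdd
  obtain ⟨c, hPD⟩ := hPD.ratio
  obtain ⟨ε₀, hε₀, hOS⟩ := hU
  obtain ⟨θ, hθ, hθhalf, hcθ⟩ := exists_ratio_mul_le_half c
  have hθ1 : θ ≤ 1 := hθhalf.trans (by norm_num)
  -- the essential bound on `Q_R(z)`
  set M : ℝ≥0∞ := eLpNorm (uncurry u) ∞ (volume.restrict (parabolicCylinder R z)) with hMdef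
  have hM : ∀ᵐ w ∂(volume.restrict (parabolicCylinder R z)), ‖u w.1 w.2‖ₑ ≤ M :=
    ae_enorm_le_eLpNorm_top u _
  have hMtop : M ≠ ∞ := hbdd.ne
  -- a closed box `K` around `z` inside `O`, of size `r₁ ≤ R`
  obtain ⟨r₂, hr₂, -, hKO₂⟩ := exists_closedCylinder_subset O.isOpen hz
  set r₁ : ℝ := min r₂ R with hr₁def
  have hr₁ : 0 < r₁ := lt_min hr₂ hR
  have hr₁R : r₁ ≤ R := min_le_right _ _
  set K : Set (ℝ × (EuclideanSpace ℝ (Fin 3))) := Icc (z.1 - r₁ ^ 2) (z.1 + r₁ ^ 2) ×ˢ closedBall z.2 r₁ with hKdef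
  have hKO : K ⊆ (O : Set (ℝ × (EuclideanSpace ℝ (Fin 3)))) := by
    refine Subset.trans (prod_mono (Icc_subset_Icc ?_ ?_) (closedBall_subset_closedBall (min_le_left _ _))) hKO₂
    · have : r₁ ^ 2 ≤ r₂ ^ 2 := pow_le_pow_left₀ hr₁.le (min_le_left _ _) 2
      linarith
    · have : r₁ ^ 2 ≤ r₂ ^ 2 := pow_le_pow_left₀ hr₁.le (min_le_left _ _) 2
      linarith
  have hKc : IsCompact K := isCompact_Icc.prod (isCompact_closedBall _ _)
  -- data on `K`
  obtain ⟨G, hG, hGL2, -⟩ := hsws.localEnergy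
  obtain ⟨CK, hCK⟩ := hsws.energyClass K hKO hKc
  have hNG := hGL2 K hKO hKc
  have hNp := hsws.pressure K hKO hKc
  -- cylinders `Q_r(t + h, x)` with `0 ≤ h ≤ r₁²`, `0 < r ≤ r₁` lie in the box
  have hbox : ∀ h r, 0 ≤ h → h ≤ r₁ ^ 2 → 0 < r → r ≤ r₁ →
      closure (parabolicCylinder r (z.1 + h, z.2)) ⊆ K :=
    fun h r h0 hh hr hrr => closure_parabolicCylinder_shift_subset_box h0 hh hr hrr z
  -- constants: `V₁ = |B₁|`, `Θ = θ⁻²`, `L = 1 + 2 c Θ`, `ε = ε₀`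
  set V₁ : ℝ≥0∞ := volume (ball (0 : (EuclideanSpace ℝ (Fin 3))) 1) with hV₁
  have hV₁top : V₁ ≠ ∞ := measure_ball_lt_top.ne
  set Θ : ℝ≥0∞ := ENNReal.ofReal ((θ⁻¹) ^ 2) with hΘ
  set L : ℝ≥0∞ := 1 + 2 * ((c : ℝ≥0∞) * Θ) with hL
  have hLtop : L ≠ ∞ := ENNReal.add_ne_top.2 ⟨ENNReal.one_ne_top,
    ENNReal.mul_ne_top ENNReal.ofNat_ne_top (ENNReal.mul_ne_top ENNReal.coe_ne_top ENNReal.ofReal_ne_top)⟩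
  set ε : ℝ≥0∞ := ENNReal.ofReal ε₀ with hεdef
  have hε4 : 0 < ε / 4 := ENNReal.div_pos (ENNReal.ofReal_pos.2 hε₀).ne' ENNReal.ofNat_ne_top
  -- (A) the radius `r₀ ≤ r₁`: `L |B₁| M³ r₀³ ≤ ε/4`
  obtain ⟨rA, hrA, hA⟩ := exists_forall_ofReal_pow_three_mul_le (N := L * (V₁ * M ^ 3))
    (ENNReal.mul_ne_top hLtop (ENNReal.mul_ne_top hV₁top (ENNReal.pow_ne_top hMtop))) hε4
  set r₀ : ℝ := min r₁ rA with hr₀def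
  have hr₀ : 0 < r₀ := lt_min hr₁ hrA
  have hr₀r₁ : r₀ ≤ r₁ := min_le_left _ _
  have hr₀R : r₀ ≤ R := hr₀r₁.trans hr₁R
  have hAr₀ : ENNReal.ofReal (r₀ ^ 3) * (L * (V₁ * M ^ 3)) ≤ ε / 4 := hA r₀ hr₀ (min_le_right _ _)
  -- (B) the number of steps `J`: `2^{-J} r₀⁻² ∫_K |p|^{3/2} ≤ ε/4`
  set P : ℝ≥0∞ := (ENNReal.ofReal r₀ ^ 2)⁻¹ * ∫⁻ w in K, ‖p w.1 w.2‖ₑ ^ (3 / 2 : ℝ) with hPdef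
  have hPtop : P ≠ ∞ :=
    ENNReal.mul_ne_top (ENNReal.inv_ne_top.2 (pow_ne_zero 2 (ENNReal.ofReal_pos.2 hr₀).ne')) hNp.ne
  obtain ⟨J, hJ⟩ := exists_inv_two_pow_mul_le hPtop hε4
  -- the final scale `s = θᴶ r₀`
  set s : ℝ := θ ^ J * r₀ with hsdef
  have hs : 0 < s := by positivity
  have hsr₀ : s ≤ r₀ := mul_le_of_le_one_left hr₀.le (pow_le_one₀ hθ.le hθ1)
  have hscale0 : ∀ j : ℕ, 0 < θ ^ j * r₀ := fun j => by positivity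
  have hscale1 : ∀ j : ℕ, θ ^ j * r₀ ≤ r₀ := fun j =>
    mul_le_of_le_one_left hr₀.le (pow_le_one₀ hθ.le hθ1)
  have hscale2 : ∀ j ≤ J, s ≤ θ ^ j * r₀ := fun j hj =>
    mul_le_mul_of_nonneg_right (pow_le_pow_of_le_one hθ.le hθ1 hj) hr₀.le
  -- (C) the shift `h`: the slab term is small and `h ≤ s²/8`
  have hcubefin : ∫⁻ w in parabolicCylinder r₀ (z.1 + r₀ ^ 2, z.2), ‖u w.1 w.2‖ₑ ^ (3 : ℕ) < ∞ := by
    have hsub : parabolicCylinder r₀ (z.1 + r₀ ^ 2, z.2) ⊆ K :=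
      subset_closure.trans (hbox (r₀ ^ 2) r₀ (by positivity)
        (pow_le_pow_left₀ hr₀.le hr₀r₁ 2) hr₀ hr₀r₁)
    exact lintegral_cube_parabolicCylinder_lt_top_of_energy hG hKO hCK hNG hr₀ hsub
  have hslab := tendsto_lintegral_cube_slab (u := u) (z := z) hr₀ hcubefin
  have hslab' : Tendsto (fun n : ℕ => L * (ENNReal.ofReal s ^ 2)⁻¹ *
      ∫⁻ w in Ioo z.1 (z.1 + r₀ ^ 2 / (n + 1)) ×ˢ ball z.2 r₀, ‖u w.1 w.2‖ₑ ^ (3 : ℕ)) atTop (𝓝 0) := by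
    have hfin : L * (ENNReal.ofReal s ^ 2)⁻¹ ≠ ∞ :=
      ENNReal.mul_ne_top hLtop (ENNReal.inv_ne_top.2 (pow_ne_zero 2 (ENNReal.ofReal_pos.2 hs).ne'))
    have := ENNReal.Tendsto.const_mul hslab (Or.inr hfin)
    rw [mul_zero] at this
    simpa only [mul_assoc] using this
  have hevC : ∀ᶠ n : ℕ in atTop, L * (ENNReal.ofReal s ^ 2)⁻¹ *
      ∫⁻ w in Ioo z.1 (z.1 + r₀ ^ 2 / (n + 1)) ×ˢ ball z.2 r₀, ‖u w.1 w.2‖ₑ ^ (3 : ℕ) ≤ ε / 4 :=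
    hslab'.eventually (ge_mem_nhds hε4)
  have hevh : ∀ᶠ n : ℕ in atTop, r₀ ^ 2 / (n + 1) ≤ s ^ 2 / 8 := by
    obtain ⟨N, hN⟩ := exists_nat_ge (8 * r₀ ^ 2 / s ^ 2)
    refine eventually_atTop.2 ⟨N, fun n hn => ?_⟩
    have hn' : 8 * r₀ ^ 2 / s ^ 2 ≤ (n : ℝ) + 1 := hN.trans (by exact_mod_cast Nat.le_succ_of_le hn)
    rw [div_le_iff₀ (by positivity)] at hn'
    rw [div_le_div_iff₀ (by positivity) (by norm_num)]
    linarith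
  obtain ⟨n, hnC, hnh⟩ := (hevC.and hevh).exists
  set h : ℝ := r₀ ^ 2 / (n + 1) with hhdef
  have hh0 : 0 < h := by positivity
  have hhs : h ≤ s ^ 2 / 8 := hnh
  have hhr₁ : h ≤ r₁ ^ 2 := by
    have h1 : h ≤ r₀ ^ 2 := div_le_self (by positivity) (by linarith)
    exact h1.trans (pow_le_pow_left₀ hr₀.le hr₀r₁ 2)
  set z' : ℝ × (EuclideanSpace ℝ (Fin 3)) := (z.1 + h, z.2) with hz'
  -- inclusions at the shifted centre
  have hclK : ∀ r, 0 < r → r ≤ r₀ → closure (parabolicCylinder r z') ⊆ K :=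
    fun r hr hrr => hbox h r hh0.le hhr₁ hr (hrr.trans hr₀r₁)
  have hclO : ∀ r, 0 < r → r ≤ r₀ → closure (parabolicCylinder r z') ⊆ (O : Set (ℝ × (EuclideanSpace ℝ (Fin 3)))) :=
    fun r hr hrr => (hclK r hr hrr).trans hKO
  -- the cubic inputs `C(θʲ r₀; z') ≤ e` for `j ≤ J`
  set Slab : ℝ≥0∞ := ∫⁻ w in Ioo z.1 (z.1 + h) ×ˢ ball z.2 r₀, ‖u w.1 w.2‖ₑ ^ (3 : ℕ) with hSlab
  set e : ℝ≥0∞ := V₁ * M ^ 3 * ENNReal.ofReal (r₀ ^ 3) + (ENNReal.ofReal s ^ 2)⁻¹ * Slab with hedef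
  have hCe : ∀ j ≤ J, cknC (θ ^ j * r₀) z' u ≤ e := by
    intro j hj
    have hQS : parabolicCylinder (θ ^ j * r₀) z ⊆ parabolicCylinder R z :=
      parabolicCylinder_mono (hscale0 j).le ((hscale1 j).trans hr₀R) z
    refine (cknC_shift_le (hscale0 j) (hscale1 j) hh0 hQS hM).trans ?_
    have h1 : ENNReal.ofReal ((θ ^ j * r₀) ^ 3) ≤ ENNReal.ofReal (r₀ ^ 3) :=
      ENNReal.ofReal_le_ofReal (pow_le_pow_left₀ (hscale0 j).le (hscale1 j) 3)
    have h2 : (ENNReal.ofReal (θ ^ j * r₀) ^ 2)⁻¹ ≤ (ENNReal.ofReal s ^ 2)⁻¹ :=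
      ENNReal.inv_le_inv.2 (pow_le_pow_left' (ENNReal.ofReal_le_ofReal (hscale2 j hj)) 2)
    exact add_le_add (mul_le_mul_right h1 (V₁ * M ^ 3)) (mul_le_mul_left h2 Slab)
  -- the pressure at the last scale (steps 1 and 3)
  have hD : cknD s z' p ≤ (2⁻¹ : ℝ≥0∞) ^ J * cknD r₀ z' p + 2 * ((c : ℝ≥0∞) * Θ * e) :=
    cknD_iterate_le_of_pressure_decay hPD hθ hθ1 hcθ hsws.distributional hr₀
      (subset_closure.trans (hclO r₀ hr₀ le_rfl)) (fun j hj => hCe j hj.le)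
  have hD0 : cknD r₀ z' p ≤ P := cknD_le_of_subset p (subset_closure.trans (hclK r₀ hr₀ le_rfl))
  -- smallness `C(s; z') + D(s; z') ≤ ε₀`
  have hsmall : cknC s z' u + cknD s z' p ≤ ε := by
    have h1 : cknC s z' u ≤ e := hCe J le_rfl
    have h2 : L * e ≤ ε / 4 + ε / 4 := by
      rw [hedef, mul_add]
      refine add_le_add ?_ ?_
      · calc L * (V₁ * M ^ 3 * ENNReal.ofReal (r₀ ^ 3))
            = ENNReal.ofReal (r₀ ^ 3) * (L * (V₁ * M ^ 3)) := by ring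
          _ ≤ ε / 4 := hAr₀
      · calc L * ((ENNReal.ofReal s ^ 2)⁻¹ * Slab) = L * (ENNReal.ofReal s ^ 2)⁻¹ * Slab := by ring
          _ ≤ ε / 4 := hnC
    have h3 : (2⁻¹ : ℝ≥0∞) ^ J * cknD r₀ z' p ≤ ε / 4 :=
      le_trans (by gcongr) hJ
    calc cknC s z' u + cknD s z' p
        ≤ e + ((2⁻¹ : ℝ≥0∞) ^ J * cknD r₀ z' p + 2 * ((c : ℝ≥0∞) * Θ * e)) := add_le_add h1 hD
      _ = L * e + (2⁻¹ : ℝ≥0∞) ^ J * cknD r₀ z' p := by rw [hL]; ring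
      _ ≤ (ε / 4 + ε / 4) + ε / 4 := add_le_add h2 h3
      _ ≤ ε := ENNReal.add_quarters_le ε
  -- the one-scale criterion at `(s, z')` and the conclusion
  have hb := hOS O u p hsws z' s hs (hclO s hs hsr₀) hsmall
  exact isRegularPoint_of_eLpNorm_shift_lt_top hs hh0 hhs hb

/-- **B from the pressure decay estimate and the one-scale criterion** (Rusin–Šverák 2011,
Prop. 2.1 with the half-open cylinder `Q_{z₀,r} = B_{x₀,r} × (t₀ - r², t₀]`, p. 4: boundedness of
`u` on a backward cylinder makes `(t₀, x₀)` itself a regular point; Robinson–Rodrigo–Sadowski 2016,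
remark after Cor. 15.5 and Cor. 15.6). If `(u, p)` is a suitable weak solution (unit viscosity, no
force) on `O ∋ z` and `u ∈ L^∞(Q_R(z))` for some `Q_R(z) ⊆ O`, then `z` is a regular point of `u`
(`IsRegularPoint`: bounded on a centred cylinder). Proof: module docstring, steps 1–4 — the
pressure decay estimate iterated along `θʲ r₀` at the shifted centre `(t + h, x)` with the cubic
inputs `C ≤ |B₁| M³ s³ + s⁻² ∫∫_{(t,t+h)×B_{r₀}} |u|³`, the parameters `r₀, J, h` chosen in this
order, then the one-scale criterion on `Q_{s_J}(t + h, x)` and `Q*_{√h}(z) ⊆ Q_{s_J/2}(t + h, x)`.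
[cite: RusinSverak2011, Prop. 2.1 (half-open Q_{z₀,r}, arXiv:0911.0500 p. 4); RobinsonRodrigoSadowski2016 Cor. 15.6] -/
theorem isRegularPoint_of_eLpNorm_parabolicCylinder_lt_top_of_pressure_decay
    (hPD : seregin_sverak_pressure_decay) (hOS : oneScaleRegularity) :
    isRegularPoint_of_eLpNorm_parabolicCylinder_lt_top :=
  isRegularPoint_of_eLpNorm_parabolicCylinder_lt_top_of_unforced hPD hOS.unforced

end Literature.Analysis.FluidPDE

end
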